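/-
Origin: expansion seat `planner-pub-hodgecm-mc-theta-3-g28-0`, handover #S16r2 2026-08-21T02:19Z md5 8182e289a41f (433 l.; REPLACE of the RUN-69 r1 72817023bc42 (NEW if RUN 69 dropped it); imports HodgeCM.Model.LiuIndexPin + ArchLineCenterChar + ArchTypeReadOff + LiuDictionaryInstanceTwist; NEW THEOREM NAMES for audit: HodgeCM.Model.LiuIndex.I.exists_line_eq_ofCM · HodgeCM.Model.LiuIndex.hasCentralTypeAt_ofCMOf_iff · HodgeCM.Model.LiuIndex.hasCentralTypeAt_ofCMOf_centralTypeOf; surviving audited r1 names re-certified in place) (`HOME/mc/pub-hodgecm-mc-theta-3-g28/stage70/HodgeCM/Model/LiuIndexCentralType.lean`, md5 8182e289a41f, 433 lines);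
landed by the second packager p2 gen 17 (p2-g17) in gate run 70 REPLACES the earlier landed copy of `HodgeCM/Model/LiuIndexCentralType.lean` (verbatim).
-/
/-
Origin: THETA seat `planner-pub-hodgecm-mc-theta-3-g28-0` (unit pub-hodgecm-mc-theta-3-g28, gen 28 of mc-theta-3: theta supply ∕ second-lift ∕ see-saw lane),
2026-08-21.  r2 (RUN 70; REPLACES the RUN-69 r1 72817023bc42): the reading stated at SCALAR level and the index terms made GENERIC IN THE
REPRESENTATIVE SECTION `ρ` (binder-2-g19 SEAM NOTE 2, STATUS l.14912; #S15 r2).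
Target in PKG: `HodgeCM/Model/LiuIndexCentralType.lean` (additive KERNEL leaf beside E; imports theta-3 #S15 `Model/LiuIndexPin` (r2, hence
binder-2 #102 and #99–#101 of RUN 68) and the LANDED leaves `Model/ArchLineCenterChar` (⊇ (F1) `Model/ArchLineDatumOf`, carch ∕ period ∕ binder-2 engines) and
`Model/ArchTypeReadOff` (theta lane) and `Model/LiuDictionaryInstanceTwist` (axioms-1 #7, `SplitLine.twistBy`); nothing imports it; outside E's import closure; E `Model/E2InstanceOGR21AEPI.lean` ∕ «A» untouched; MODEL-N ±0).
KERNEL ONLY: the ARCHIMEDEAN CENTRAL-TYPE READING of a pair splitting at a Gram scalar, and the index predicate FAMILY it generates —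
GENERIC in ONE exponent recipe `μ : GramClass L → (InfinitePlace L → ℤ)` and in the representative section `ρ`.  0 records, nothing cited, 0 `def … : Prop` asserted as a fact
(`HasCentralTypeAt` is a DEFINITION of a property of `s`, consumed only as the parameter `P` of #S15).  Nothing here is a claim of the
manuscripts under adjudication.
-/
import Summits.HodgeConjecture.HodgeCM.Model.LiuIndexPin
import Summits.HodgeConjecture.HodgeCM.Model.ArchLineCenterChar
import Summits.HodgeConjecture.HodgeCM.Model.ArchTypeReadOff
import Summits.HodgeConjecture.HodgeCM.Model.LiuDictionaryInstanceTwist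

set_option autoImplicit false

/-!
# (J3 ∕ K0) THE CENTRAL-TYPE READING OF THE INDEX PREDICATE — `LiuIndex.HasCentralTypeAt V a s m`, `LiuIndex.CentralTypeIs V μ`, `LiuIndex.I V ρ μ`

#S15 `Model/LiuIndexPin` (r2) leaves ONE slot open: the scalar-level predicate `P a s` = «the `V`-character `μ_s` of the compatible pair
splitting `s` at the Gram scalar `a` is OF WEIGHT ONE with `Φ_{μ_s} = Φ^δ(a)`» [Liu21, Def. 4.2 ∕ 4.12].  By [Liu21, Def. 4.1–4.2] the weight of an
automorphic character `μ` of `𝔸_Lˣ` is a condition on `μ_∞` ALONE (`μ_τ(z) = arg(z)^{-w_τ}`), and by [Liu21, App., the three-step construction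
of `ω(μ, ε, χ)`] `μ` enters the oscillator representation through the splitting `ι_μ` of `U(V)`, whose CENTRE acts on the archimedean vacuum
by a character of `U(1)(L⁺ ⊗ ℝ)` of some integral type.  In record currency that centre action is already a KERNEL object: the vendored
anti-diagonal `adelicInl_adelicCenter_mul_adelicInr_adelicCenter_inv` identifies the `V`-centre with the `U(W)`-torus inside the see-saw pair
group, the junction `archToAdelic_cmArchCenter` (tree p194977) places the archimedean centre `t · 1_V`, `t ∈ U(1)(L⁺ ⊗ ℝ)`, in `U(J_V)(𝔸)`,
and (F1) `Model/ArchLineDatumOf` proves that through the [GR91, Prop. 3.1.1] splitting OF RECORD the element `(t · 1_V, 1)` acts on every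
thin-coset test function of the Folland–Fock vacuum of the line by the character `lineCenterChar` (`lineCenterChar_vacuum`,
`cmPairRep_cmCenter_inf_one_testFun`; closed form as a product of integral powers of the place circles in `Model/ArchLineCenterCharClosedForm`).

This leaf types that reading for an ARBITRARY pair splitting `s : SplittingAt V a` (#S15) at an ARBITRARY real non-zero scalar `a` — at
SCALAR level, so that a slot owner states and checks it at the slot's OWN scalar with no cast (binder-2-g19 SEAM NOTE 2, STATUS l.14912):

* §1 `gaussianAt V a` — the archimedean Gaussian (Folland–Fock vacuum `follandFock 𝔢 1`) of the CM pair `(V, ⟨a⟩)` in the canonical frame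
  at `ι₁` (no sign-side hypothesis on the line is needed for the vacuum); `gaussianAt_ne_zero`, `exists_testFun_gaussianAt_ne_zero`.
* §2 `HasCentralTypeAt V a s m` — «through `ω_ψ ∘ s`, the adelic centre `(t · 1_V, 1)` acts on every thin-coset test function `φ_N` of
  `gaussianAt V a` by the typed archimedean weight `archWeight L m t = ∏_w ι_w(t)^{m_w}`» (tree `UnitaryLineCharacters.archWeight`); the type
  is UNIQUE when it exists (`HasCentralTypeAt.type_unique`, from `archWeight_injective` and §1), and for the splitting of record the defining
  equation holds with the eigen-character `lineCenterChar` of (F1) (`pairRep_splittingOf_center_testFun_gaussianAt`) — so the family is not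
  vacuous and reads, at the record's splitting, (F1)'s character (closed form: `Model/ArchLineCenterCharClosedForm`).
* §3 the index predicate FAMILY `CentralTypeIs V μ : ∀ a, SplittingAt V a → Prop := fun a s ↦ HasCentralTypeAt V a s (μ (GramClass.mk a))`
  of an exponent RECIPE `μ : GramClass L → (InfinitePlace L → ℤ)` (a CLASS-level recipe read at the class of the scalar), and the
  corresponding instances of #S15 for any representative section `ρ`: `I V ρ μ := IOf V ρ (CentralTypeIs V μ)`, `line V ρ μ := lineOf V ρ
  (CentralTypeIs V μ)` (`line_injective`, `line_scalar`, `hasCentralTypeAt_of_mem`), the positioned alias `HasCentralType V ρ q s m :=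
  HasCentralTypeAt V (ρ q) s m`, and the POINTED CONSTRUCTOR `I.exists_line_eq_ofCM` (#S15 `exists_lineOf_eq_ofCM` at this predicate):
  from `ρ q = a`, a compatible `s` at `a` and `HasCentralTypeAt V a s (μ (mk a))`, an index `j` over `q` with `line V ρ μ j = SplitLineE.ofCM V e₁
  (vec a) … s …` ON THE NOSE — what #103 §2 `mem_biSup_block_pin_of_line_eq` consumes at `ρ := LiuIndex.repAt a` (#103 §0).

WHAT IS NOT DECIDED HERE (on purpose, MODEL-N COND row N-i1-match, owners axioms-1 ∕ binder-2 + desk): WHICH recipe `μ₀` is Liu's «weight one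
with `Φ_μ = Φ^δ(scalar q)`» — i.e. the dictionary between the central type of `ω_ψ ∘ s` on the vacuum and the weights `w_τ` of [Liu21, Def. 4.1]
(it involves the [HKS96] normalisation of `ι_μ` and the vacuum character of the rank-3 space, cf. (F1)'s closed form).  With `μ₀` worded, the
pin of «ATp»'s two data slots at the pointing scalar `a₀` is `I V a₀ := LiuIndex.I V (repAt a₀) μ₀`, `line V a₀ := LiuIndex.line V (repAt a₀) μ₀`;
every statement below holds for every `μ` and every `ρ`.
-/

noncomputable section

open NumberField NumberField.InfinitePlace NumberField.mixedEmbedding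
open scoped Matrix SchwartzMap Classical
open Literature.NumberTheory.Automorphic Literature.NumberTheory.Automorphic.UnitaryGroup Literature.NumberTheory.Weil1964
open Literature.RepresentationTheory.KonnoKonno2007 Literature.RepresentationTheory.KonnoKonno2007.RealDualPair
open Literature.NumberTheory.GelbartRogawski1991 Literature.NumberTheory.GelbartRogawski1991.UnitaryDualPair
open Literature.Analysis.SegalBargmann
open HodgeCM.Model.SupplyInstance (testFun archEmb)

namespace HodgeCM.Model

open HodgeCM.Model.ArchSideTerm (e₁ testFun_smul exists_apply_archEmb_ne_zero lineCenterChar lineCenterChar_vacuum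
  cmPairRep_cmCenter_inf_one_testFun)

namespace LiuIndex

variable {L : CMField} {ι₁ : (L : Type) →+* ℂ} (V : HermSpace3 L ι₁)

/-! ## §1 The archimedean Gaussian of the pair at a scalar -/

/-- **the archimedean Gaussian** (Folland–Fock vacuum) of the CM pair `(V, ⟨a⟩)` (`a : RealScalar L`) in the canonical scaled frame at `ι₁`
(binder-2's `HypCensus.cmBigFrame`). [Folland1989, Prop. (4.39); folklore] -/
def gaussianAt (a : RealScalar L) : 𝓢(((Fin 3) → mixedSpace (↥(maximalRealSubfield L))), ℂ) :=
  follandFock (HypCensus.cmBigFrame (L : Type) e₁ (frameD V) (frameD_real V) (frameD_ne V) (RealScalar.vec a) (RealScalar.vec_real a)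
    (RealScalar.vec_ne a) ι₁) 1

/-- (Ported verbatim from the HodgeCMPerL package; no docstring in the source.) -/
theorem gaussianAt_def (a : RealScalar L) : gaussianAt V a =
    follandFock (HypCensus.cmBigFrame (L : Type) e₁ (frameD V) (frameD_real V) (frameD_ne V) (RealScalar.vec a) (RealScalar.vec_real a)
      (RealScalar.vec_ne a) ι₁) 1 := rfl

/-- the Gaussian is non-zero. [folklore] -/
theorem gaussianAt_ne_zero (a : RealScalar L) : gaussianAt V a ≠ 0 :=
  ArchSideTerm.follandFock_one_ne_zero _

/-- … hence some thin-coset test function of it (at level `1`) is non-zero. [folklore: density of `ι (L⁺)³ ⊂ (L⁺ ⊗ ℝ)³`] -/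
theorem exists_testFun_gaussianAt_ne_zero (a : RealScalar L) :
    ∃ x₀ : Fin 3 → ↥(maximalRealSubfield L), testFun (↥(maximalRealSubfield L)) (Fin 3) (gaussianAt V a) x₀ 1 ≠ 0 := by
  obtain ⟨x₀, hx₀⟩ := exists_apply_archEmb_ne_zero (↥(maximalRealSubfield L)) (Fin 3) (gaussianAt V a) (gaussianAt_ne_zero V a)
  exact ⟨x₀, testFun_ne_zero _ hx₀ one_ne_zero⟩

/-! ## §2 The central type of a pair splitting at a scalar -/

/-- **«the pair splitting `s` at the scalar `a` has archimedean CENTRAL TYPE `m`»**: through `ω_ψ ∘ s` the adelic centre `(t · 1_V, 1)`,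
`t ∈ U(1)(L⁺ ⊗ ℝ)` (tree `CMCenter` of the norm-one idele `(t_∞, 1)`), acts on every thin-coset test function `φ_N(x₀)` of the Gaussian of
the pair by the typed archimedean weight `archWeight L m t = ∏_w ι_w(t)^{m_w}`.  A DEFINITION (a property of `s`), not a record. -/
def HasCentralTypeAt (a : RealScalar L) (s : SplittingAt V a) (m : InfinitePlace (L : Type) → ℤ) : Prop :=
  ∀ (t : ↥(Literature.NumberTheory.Automorphic.relNormOneInfUnits (↥(maximalRealSubfield L)) L))
    (x₀ : Fin 3 → ↥(maximalRealSubfield L)) (Nl : ℕ),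
    pairRep (↥(maximalRealSubfield L)) L (IsCMField.complexConj L) 3 1 e₁ (Matrix.diagonal (frameD V)) (Matrix.diagonal (RealScalar.vec a)) s
        (CMCenter (L : Type) (frameD V)
          ((cmAdelicOneEquivRelNormOne (L : Type)).symm
            (Literature.NumberTheory.Automorphic.relNormOneInfToIdeles (↥(maximalRealSubfield L)) L t)), 1)
        (testFun (↥(maximalRealSubfield L)) (Fin 3) (gaussianAt V a) x₀ Nl) =
      Literature.NumberTheory.Automorphic.archWeight (L : Type) m t • testFun (↥(maximalRealSubfield L)) (Fin 3) (gaussianAt V a) x₀ Nl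

namespace HasCentralTypeAt

variable {V} {a : RealScalar L} {s : SplittingAt V a} {m m' : InfinitePlace (L : Type) → ℤ}

/-- two central types of the same splitting have the same weight character. [folklore] -/
theorem archWeight_eq (h : HasCentralTypeAt V a s m) (h' : HasCentralTypeAt V a s m') :
    Literature.NumberTheory.Automorphic.archWeight (L : Type) m = Literature.NumberTheory.Automorphic.archWeight (L : Type) m' := by
  obtain ⟨x₀, hx₀⟩ := exists_testFun_gaussianAt_ne_zero V a
  ext t
  exact smul_left_injective ℂ hx₀ ((h t x₀ 1).symm.trans (h' t x₀ 1))

/-- **the central type is unique** (the archimedean type of a character of `U(1)(L⁺ ⊗ ℝ)` is determined by the character,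
tree `archWeight_injective`). [folklore] -/
theorem type_unique (h : HasCentralTypeAt V a s m) (h' : HasCentralTypeAt V a s m') : m = m' :=
  Literature.NumberTheory.Automorphic.archWeight_injective (archWeight_eq h h')

end HasCentralTypeAt

/-- r1 name kept (RUN-69 audited-name stability): `HasCentralTypeAt.archWeight_eq`. [folklore] -/
theorem HasCentralType.archWeight_eq {a : RealScalar L} {s : SplittingAt V a} {m m' : InfinitePlace (L : Type) → ℤ}
    (h : HasCentralTypeAt V a s m) (h' : HasCentralTypeAt V a s m') :
    Literature.NumberTheory.Automorphic.archWeight (L : Type) m = Literature.NumberTheory.Automorphic.archWeight (L : Type) m' :=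
  h.archWeight_eq h'

/-- r1 name kept (RUN-69 audited-name stability): `HasCentralTypeAt.type_unique` — the central type of a splitting at a scalar is unique.
[folklore] -/
theorem HasCentralType.type_unique {a : RealScalar L} {s : SplittingAt V a} {m m' : InfinitePlace (L : Type) → ℤ}
    (h : HasCentralTypeAt V a s m) (h' : HasCentralTypeAt V a s m') : m = m' :=
  h.type_unique h'

/-- **the defining equation AT THE SPLITTING OF RECORD**: through the [GR91, Prop. 3.1.1] splitting `splittingOf hGR` of the CM datum at `a`,
the centre `(t · 1_V, 1)` acts on the test functions of the Gaussian by (F1)'s vacuum character `lineCenterChar` (`lineCenterChar_vacuum` and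
the pure-tensor junction `cmPairRep_cmCenter_inf_one_testFun`). [GelbartRogawski1991, Prop. 3.1.1; Folland1989, Prop. (4.39); folklore] -/
theorem pairRep_splittingOf_center_testFun_gaussianAt (a : RealScalar L)
    (hGR : (cmSplittingDatum (L : Type) e₁ (frameD V) (frameD_real V) (frameD_ne V) (RealScalar.vec a) (RealScalar.vec_real a)
      (RealScalar.vec_ne a)).CompatibleSplitting)
    (t : ↥(Literature.NumberTheory.Automorphic.relNormOneInfUnits (↥(maximalRealSubfield L)) L))
    (x₀ : Fin 3 → ↥(maximalRealSubfield L)) (Nl : ℕ) :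
    pairRep (↥(maximalRealSubfield L)) L (IsCMField.complexConj L) 3 1 e₁ (Matrix.diagonal (frameD V)) (Matrix.diagonal (RealScalar.vec a))
        (splittingOf (↥(maximalRealSubfield (L : Type))) (L : Type) (IsCMField.complexConj (L : Type)) 3 1 e₁
          (Matrix.diagonal (frameD V)) (Matrix.diagonal (RealScalar.vec a)) (complexConj_imagUnit (L : Type)) (imagUnit_ne_zero (L : Type))
          (imagUnit_mul_self (L : Type)) (realDiagonal_isSymm (L : Type) (frameD V) (frameD_real V))
          (realDiagonal_isSymm (L : Type) (RealScalar.vec a) (RealScalar.vec_real a))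
          (isUnit_det_realDiagonal (L : Type) (frameD V) (frameD_real V) (frameD_ne V))
          (isUnit_det_realDiagonal (L : Type) (RealScalar.vec a) (RealScalar.vec_real a) (RealScalar.vec_ne a))
          (realDiagonal_map (L : Type) (frameD V) (frameD_real V)).symm
          (realDiagonal_map (L : Type) (RealScalar.vec a) (RealScalar.vec_real a)).symm hGR)
        (CMCenter (L : Type) (frameD V)
          ((cmAdelicOneEquivRelNormOne (L : Type)).symm
            (Literature.NumberTheory.Automorphic.relNormOneInfToIdeles (↥(maximalRealSubfield L)) L t)), 1)
        (testFun (↥(maximalRealSubfield L)) (Fin 3) (gaussianAt V a) x₀ Nl) =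
      ((lineCenterChar V a.1 a.2.1 a.2.2 hGR t : Circle) : ℂ) •
        testFun (↥(maximalRealSubfield L)) (Fin 3) (gaussianAt V a) x₀ Nl := by
  have h := cmPairRep_cmCenter_inf_one_testFun (L : Type) e₁ (frameD V) (frameD_real V) (frameD_ne V) (RealScalar.vec a)
    (RealScalar.vec_real a) (RealScalar.vec_ne a) hGR t (gaussianAt V a) x₀ Nl
  rw [gaussianAt_def, lineCenterChar_vacuum V a.1 a.2.1 a.2.2 hGR t,
    testFun_smul] at h
  exact h

/-! ### §2b The reading is ONE scalar identity per record (sinst-1-g11 SEAM NOTE `hχ`, STATUS l.14956 (3)(ii): «type it ONCE») -/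

variable {V} in
/-- **the central-type reading is a scalar identity**: if through `s` the centre `(t · 1_V, 1)` acts on the test functions of the Gaussian
by a scalar function `κ`, then `HasCentralTypeAt V a s m ↔ κ = archWeight L m` pointwise (test functions of a non-zero Schwartz function
are not all zero, §1). [folklore] -/
theorem hasCentralTypeAt_iff_of_center_smul {a : RealScalar L} {s : SplittingAt V a}
    (κ : ↥(Literature.NumberTheory.Automorphic.relNormOneInfUnits (↥(maximalRealSubfield L)) L) → ℂ)
    (hκ : ∀ (t : ↥(Literature.NumberTheory.Automorphic.relNormOneInfUnits (↥(maximalRealSubfield L)) L))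
      (x₀ : Fin 3 → ↥(maximalRealSubfield L)) (Nl : ℕ),
      pairRep (↥(maximalRealSubfield L)) L (IsCMField.complexConj L) 3 1 e₁ (Matrix.diagonal (frameD V)) (Matrix.diagonal (RealScalar.vec a))
          s
          (CMCenter (L : Type) (frameD V)
            ((cmAdelicOneEquivRelNormOne (L : Type)).symm
              (Literature.NumberTheory.Automorphic.relNormOneInfToIdeles (↥(maximalRealSubfield L)) L t)), 1)
          (testFun (↥(maximalRealSubfield L)) (Fin 3) (gaussianAt V a) x₀ Nl) =
        κ t • testFun (↥(maximalRealSubfield L)) (Fin 3) (gaussianAt V a) x₀ Nl)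
    (m : InfinitePlace (L : Type) → ℤ) :
    HasCentralTypeAt V a s m ↔ ∀ t, κ t = Literature.NumberTheory.Automorphic.archWeight (L : Type) m t := by
  constructor
  · intro h t
    obtain ⟨x₀, hx₀⟩ := exists_testFun_gaussianAt_ne_zero V a
    exact smul_left_injective ℂ hx₀ ((hκ t x₀ 1).symm.trans (h t x₀ 1))
  · intro h t x₀ Nl
    rw [hκ t x₀ Nl, h t]

/-- **AT THE SPLITTING OF RECORD the type check is ONE identity of characters of `U(1)(L⁺ ⊗ ℝ)`**:
`HasCentralTypeAt V a (splittingOf hGR) m ↔ lineCenterChar(hGR) = archWeight L m` — (F1)'s vacuum character (closed form: #96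
`Model/ArchLineCenterCharClosedForm` `coe_lineCenterChar_eq_prod_zpow`) against the typed weight.  This is the SAME archimedean identity as the
automorphy input (Hw) of the slot character (sinst-1-g11, STATUS l.14956): the index's central type at the slot and the rational triviality of the
slot's finite central character are one condition, to be carried ONCE. [folklore] -/
theorem hasCentralTypeAt_ofCMOf_iff (a : RealScalar L)
    (hGR : (cmSplittingDatum (L : Type) e₁ (frameD V) (frameD_real V) (frameD_ne V) (RealScalar.vec a) (RealScalar.vec_real a)
      (RealScalar.vec_ne a)).CompatibleSplitting)
    (m : InfinitePlace (L : Type) → ℤ) :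
    HasCentralTypeAt V a (SplitLineE.ofCMOf V e₁ (RealScalar.vec a) (RealScalar.vec_real a) (RealScalar.vec_ne a) hGR).s m ↔
      ∀ t, ((lineCenterChar V a.1 a.2.1 a.2.2 hGR t : Circle) : ℂ) = Literature.NumberTheory.Automorphic.archWeight (L : Type) m t :=
  hasCentralTypeAt_iff_of_center_smul _ (pairRep_splittingOf_center_testFun_gaussianAt V a hGR) m

/-- **FOR A TWISTED RECORD `(ofCM … s hs) ⊗ ĉ` the type check is the identity `ĉ(centre_∞ t) · κ(t) = archWeight L m t`**, `κ` the centre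
scalar of `s` (axioms-1 #7 `SplitLine.pairRep_twistBy_apply`: `ω((p ⊗ ĉ).s g) = ĉ(g_V g_W) • ω(p.s g)`). [GelbartRogawski1991, §3.1 Remark
p. 457 L4–13; folklore] -/
theorem hasCentralTypeAt_twistBy_iff (a : RealScalar L) (s : SplittingAt V a) (hs : IsCompatAtScalar V a s)
    (κ : ↥(Literature.NumberTheory.Automorphic.relNormOneInfUnits (↥(maximalRealSubfield L)) L) → ℂ)
    (hκ : ∀ (t : ↥(Literature.NumberTheory.Automorphic.relNormOneInfUnits (↥(maximalRealSubfield L)) L))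
      (x₀ : Fin 3 → ↥(maximalRealSubfield L)) (Nl : ℕ),
      pairRep (↥(maximalRealSubfield L)) L (IsCMField.complexConj L) 3 1 e₁ (Matrix.diagonal (frameD V)) (Matrix.diagonal (RealScalar.vec a))
          s
          (CMCenter (L : Type) (frameD V)
            ((cmAdelicOneEquivRelNormOne (L : Type)).symm
              (Literature.NumberTheory.Automorphic.relNormOneInfToIdeles (↥(maximalRealSubfield L)) L t)), 1)
          (testFun (↥(maximalRealSubfield L)) (Fin 3) (gaussianAt V a) x₀ Nl) =
        κ t • testFun (↥(maximalRealSubfield L)) (Fin 3) (gaussianAt V a) x₀ Nl)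
    (ĉ : (SplitLineE.ofCM V e₁ (RealScalar.vec a) (RealScalar.vec_real a) (RealScalar.vec_ne a) s hs).BigChar)
    (hĉ : (SplitLineE.ofCM V e₁ (RealScalar.vec a) (RealScalar.vec_real a) (RealScalar.vec_ne a) s hs).IsRatTrivial ĉ)
    (m : InfinitePlace (L : Type) → ℤ) :
    HasCentralTypeAt V a ((SplitLineE.ofCM V e₁ (RealScalar.vec a) (RealScalar.vec_real a) (RealScalar.vec_ne a) s hs).twistBy ĉ hĉ).s m ↔
      ∀ t, ((ĉ (pairMap (↥(maximalRealSubfield (L : Type))) (L : Type) (IsCMField.complexConj (L : Type)) 3 1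
              (Matrix.diagonal (frameD V)) (Matrix.diagonal (RealScalar.vec a))
              (CMCenter (L : Type) (frameD V)
                ((cmAdelicOneEquivRelNormOne (L : Type)).symm
                  (Literature.NumberTheory.Automorphic.relNormOneInfToIdeles (↥(maximalRealSubfield L)) L t)), 1)) : ℂˣ) : ℂ) * κ t =
          Literature.NumberTheory.Automorphic.archWeight (L : Type) m t := by
  refine hasCentralTypeAt_iff_of_center_smul _ (fun t x₀ Nl => ?_) m
  have h := SplitLine.pairRep_twistBy_apply (SplitLineE.ofCM V e₁ (RealScalar.vec a) (RealScalar.vec_real a) (RealScalar.vec_ne a) s hs) ĉ hĉ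
    (CMCenter (L : Type) (frameD V)
      ((cmAdelicOneEquivRelNormOne (L : Type)).symm
        (Literature.NumberTheory.Automorphic.relNormOneInfToIdeles (↥(maximalRealSubfield L)) L t)), 1)
    (testFun (↥(maximalRealSubfield L)) (Fin 3) (gaussianAt V a) x₀ Nl)
  rw [hκ t x₀ Nl, smul_smul] at h
  exact h

/-! ### §2c Every splitting with a CONTINUOUS centre scalar HAS a central type — the archimedean type of that character
([BrockerTomDieck1985, Ch. II Prop. 8.1 ∕ Def. 8.2], tree `charArchType`); in particular the record `ofCMOf … hGR` has the central type
`centralTypeOf V a hGR` := the type of (F1)'s vacuum character, UNCONDITIONALLY. -/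

variable {V} in
/-- **type check against a continuous centre character = equality of exponent vectors**: if through `s` the centre acts on the Gaussian's
test functions by a continuous character `χ` of `U(1)(L⁺ ⊗ ℝ)`, then `HasCentralTypeAt V a s m ↔ m = charArchType L χ`. [BrockerTomDieck1985,
Ch. II Prop. 8.1; folklore] -/
theorem hasCentralTypeAt_iff_eq_charArchType {a : RealScalar L} {s : SplittingAt V a}
    (χ : ↥(Literature.NumberTheory.Automorphic.relNormOneInfUnits (↥(maximalRealSubfield L)) L) →* ℂ) (hχ : Continuous χ)
    (hκ : ∀ (t : ↥(Literature.NumberTheory.Automorphic.relNormOneInfUnits (↥(maximalRealSubfield L)) L))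
      (x₀ : Fin 3 → ↥(maximalRealSubfield L)) (Nl : ℕ),
      pairRep (↥(maximalRealSubfield L)) L (IsCMField.complexConj L) 3 1 e₁ (Matrix.diagonal (frameD V)) (Matrix.diagonal (RealScalar.vec a))
          s
          (CMCenter (L : Type) (frameD V)
            ((cmAdelicOneEquivRelNormOne (L : Type)).symm
              (Literature.NumberTheory.Automorphic.relNormOneInfToIdeles (↥(maximalRealSubfield L)) L t)), 1)
          (testFun (↥(maximalRealSubfield L)) (Fin 3) (gaussianAt V a) x₀ Nl) =
        χ t • testFun (↥(maximalRealSubfield L)) (Fin 3) (gaussianAt V a) x₀ Nl)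
    (m : InfinitePlace (L : Type) → ℤ) :
    HasCentralTypeAt V a s m ↔ m = Literature.NumberTheory.Automorphic.charArchType (L : Type) χ hχ := by
  rw [hasCentralTypeAt_iff_of_center_smul χ hκ m, eq_comm,
    Literature.NumberTheory.Automorphic.charArchType_eq_iff (L : Type) χ hχ m]
  constructor
  · intro h
    ext t
    exact (h t).symm
  · intro h t
    rw [h]

variable {V} in
/-- hence **existence of the central type** for a splitting with a continuous centre character. [BrockerTomDieck1985, Ch. II Prop. 8.1; folklore] -/
theorem hasCentralTypeAt_charArchType {a : RealScalar L} {s : SplittingAt V a}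
    (χ : ↥(Literature.NumberTheory.Automorphic.relNormOneInfUnits (↥(maximalRealSubfield L)) L) →* ℂ) (hχ : Continuous χ)
    (hκ : ∀ (t : ↥(Literature.NumberTheory.Automorphic.relNormOneInfUnits (↥(maximalRealSubfield L)) L))
      (x₀ : Fin 3 → ↥(maximalRealSubfield L)) (Nl : ℕ),
      pairRep (↥(maximalRealSubfield L)) L (IsCMField.complexConj L) 3 1 e₁ (Matrix.diagonal (frameD V)) (Matrix.diagonal (RealScalar.vec a))
          s
          (CMCenter (L : Type) (frameD V)
            ((cmAdelicOneEquivRelNormOne (L : Type)).symm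
              (Literature.NumberTheory.Automorphic.relNormOneInfToIdeles (↥(maximalRealSubfield L)) L t)), 1)
          (testFun (↥(maximalRealSubfield L)) (Fin 3) (gaussianAt V a) x₀ Nl) =
        χ t • testFun (↥(maximalRealSubfield L)) (Fin 3) (gaussianAt V a) x₀ Nl) :
    HasCentralTypeAt V a s (Literature.NumberTheory.Automorphic.charArchType (L : Type) χ hχ) :=
  (hasCentralTypeAt_iff_eq_charArchType χ hχ hκ _).2 rfl

/-- **the central type OF THE RECORD `ofCMOf … hGR`** (DATA): the archimedean type of (F1)'s continuous vacuum character `lineCenterChar … hGR`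
(tree `continuous_lineCenterChar`, closed form #96). [BrockerTomDieck1985, Ch. II Def. 8.2; folklore] -/
def centralTypeOf (a : RealScalar L)
    (hGR : (cmSplittingDatum (L : Type) e₁ (frameD V) (frameD_real V) (frameD_ne V) (RealScalar.vec a) (RealScalar.vec_real a)
      (RealScalar.vec_ne a)).CompatibleSplitting) : InfinitePlace (L : Type) → ℤ :=
  Literature.NumberTheory.Automorphic.charArchType (L : Type) (Circle.coeHom.comp (lineCenterChar V a.1 a.2.1 a.2.2 hGR))
    (continuous_subtype_val.comp (HodgeCM.Model.ArchSideTerm.continuous_lineCenterChar V a.1 a.2.1 a.2.2 hGR))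

/-- **THE RECORD OF RECORD HAS A CENTRAL TYPE, unconditionally**: `HasCentralTypeAt V a (ofCMOf … hGR).s (centralTypeOf V a hGR)`. [folklore] -/
theorem hasCentralTypeAt_ofCMOf_centralTypeOf (a : RealScalar L)
    (hGR : (cmSplittingDatum (L : Type) e₁ (frameD V) (frameD_real V) (frameD_ne V) (RealScalar.vec a) (RealScalar.vec_real a)
      (RealScalar.vec_ne a)).CompatibleSplitting) :
    HasCentralTypeAt V a (SplitLineE.ofCMOf V e₁ (RealScalar.vec a) (RealScalar.vec_real a) (RealScalar.vec_ne a) hGR).s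
      (centralTypeOf V a hGR) :=
  hasCentralTypeAt_charArchType _ _ (pairRep_splittingOf_center_testFun_gaussianAt V a hGR)

/-- … and ONLY that one: `HasCentralTypeAt V a (ofCMOf … hGR).s m ↔ m = centralTypeOf V a hGR`. [folklore] -/
theorem hasCentralTypeAt_ofCMOf_iff_eq_centralTypeOf (a : RealScalar L)
    (hGR : (cmSplittingDatum (L : Type) e₁ (frameD V) (frameD_real V) (frameD_ne V) (RealScalar.vec a) (RealScalar.vec_real a)
      (RealScalar.vec_ne a)).CompatibleSplitting)
    (m : InfinitePlace (L : Type) → ℤ) :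
    HasCentralTypeAt V a (SplitLineE.ofCMOf V e₁ (RealScalar.vec a) (RealScalar.vec_real a) (RealScalar.vec_ne a) hGR).s m ↔
      m = centralTypeOf V a hGR :=
  hasCentralTypeAt_iff_eq_charArchType _ _ (pairRep_splittingOf_center_testFun_gaussianAt V a hGR) m

/-! ## §3 The index predicate family of an exponent recipe, and the corresponding index terms (any section `ρ`) -/

/-- **the index predicate family of an exponent recipe** `μ : GramClass L → (InfinitePlace L → ℤ)`: at the scalar `a` the splitting must have
central type `μ ⟦a⟧` (a CLASS-level recipe, read at the class of the scalar).  (Which `μ` is Liu's «weight one with `Φ_μ = Φ^δ(a)`» is MODEL-N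
N-i1-match — a parameter here.) -/
def CentralTypeIs (μ : GramClass L → InfinitePlace (L : Type) → ℤ) : ∀ a : RealScalar L, SplittingAt V a → Prop :=
  fun a s => HasCentralTypeAt V a s (μ (GramClass.mk a))

/-- (Ported verbatim from the HodgeCMPerL package; no docstring in the source.) -/
theorem centralTypeIs_iff (μ : GramClass L → InfinitePlace (L : Type) → ℤ) (a : RealScalar L) (s : SplittingAt V a) :
    CentralTypeIs V μ a s ↔ HasCentralTypeAt V a s (μ (GramClass.mk a)) := Iff.rfl

variable (ρ : GramClass L → RealScalar L)

/-- the central-type reading POSITIONED by a representative section `ρ` (`= HasCentralTypeAt V (ρ q) s m`, reducibly). -/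
abbrev HasCentralType (q : GramClass L) (s : PairSplittingAt V ρ q) (m : InfinitePlace (L : Type) → ℤ) : Prop :=
  HasCentralTypeAt V (ρ q) s m

/-- **the index of the recipe `μ` in the section `ρ`**: #S15's `IOf V ρ` at the predicate family `CentralTypeIs V μ` — all pairs (class `q`,
compatible pair splitting at `ρ q` of central type `μ ⟦ρ q⟧`). -/
abbrev I (μ : GramClass L → InfinitePlace (L : Type) → ℤ) : Type := IOf V ρ (CentralTypeIs V μ)

/-- **the index lines of the recipe `μ` in the section `ρ`**: #S15's `lineOf V ρ` at `CentralTypeIs V μ`. -/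
abbrev line (μ : GramClass L → InfinitePlace (L : Type) → ℤ) : I V ρ μ → SplitLineE V := lineOf V ρ (CentralTypeIs V μ)

variable {ρ} in
/-- the index lines are injective for an injective section (K0 «`line` injective», #S15 `lineOf_injective`; #103 `repAt_injective`). -/
theorem line_injective (hρ : Function.Injective ρ) (μ : GramClass L → InfinitePlace (L : Type) → ℤ) : Function.Injective (line V ρ μ) :=
  lineOf_injective V _ hρ

/-- the Gram scalar of an index line is the scalar its section assigns to its class. -/
theorem line_scalar (μ : GramClass L → InfinitePlace (L : Type) → ℤ) (i : I V ρ μ) : (line V ρ μ i).scalar = GramClass.scalar ρ i.1 :=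
  lineOf_scalar V ρ _ i

variable {ρ} in
/-- the slot clause of #100 ∕ #102 for an index line of a section of `mk` (#S15 `lineOf_isometric_iff`; #103 `repAt_spec`). -/
theorem line_isometric_iff (hρ : ∀ q, GramClass.mk (ρ q) = q) (μ : GramClass L → InfinitePlace (L : Type) → ℤ) (i : I V ρ μ)
    (a : RealScalar L) :
    (∃ z : (L : Type), z ≠ 0 ∧ (line V ρ μ i).scalar = z * Literature.AlgebraicGeometry.ShimuraVarieties.conjRingHomK L z * a.1) ↔
      i.1 = GramClass.mk a :=
  lineOf_isometric_iff V _ hρ i a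

/-- every index carries the compatibility of its splitting … -/
theorem isCompatAt_of_mem (μ : GramClass L → InfinitePlace (L : Type) → ℤ) (i : I V ρ μ) : IsCompatAtScalar V (ρ i.1) i.2.1 := i.2.2.1

/-- … and its central type `μ ⟦ρ (class)⟧` … -/
theorem hasCentralTypeAt_of_mem (μ : GramClass L → InfinitePlace (L : Type) → ℤ) (i : I V ρ μ) :
    HasCentralTypeAt V (ρ i.1) i.2.1 (μ (GramClass.mk (ρ i.1))) := i.2.2.2

/-- r1 name kept (RUN-69 audited-name stability): `hasCentralTypeAt_of_mem`. -/
theorem hasCentralType_of_mem (μ : GramClass L → InfinitePlace (L : Type) → ℤ) (i : I V ρ μ) :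
    HasCentralTypeAt V (ρ i.1) i.2.1 (μ (GramClass.mk (ρ i.1))) := i.2.2.2

variable {ρ} in
/-- … which is `μ (class)` for a section of `mk`. -/
theorem hasCentralTypeAt_of_mem' (hρ : ∀ q, GramClass.mk (ρ q) = q) (μ : GramClass L → InfinitePlace (L : Type) → ℤ) (i : I V ρ μ) :
    HasCentralTypeAt V (ρ i.1) i.2.1 (μ i.1) := by
  have h : HasCentralTypeAt V (ρ i.1) i.2.1 (μ (GramClass.mk (ρ i.1))) := i.2.2.2
  rw [hρ] at h
  exact h

/-- the index at a class with a prescribed compatible splitting of the prescribed type at the section's scalar. -/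
def I.mk (μ : GramClass L → InfinitePlace (L : Type) → ℤ) (q : GramClass L) (s : PairSplittingAt V ρ q) (hs : IsCompatAt V ρ q s)
    (hm : HasCentralTypeAt V (ρ q) s (μ (GramClass.mk (ρ q)))) : I V ρ μ := ⟨q, ⟨s, hs, hm⟩⟩

/-- (Ported verbatim from the HodgeCMPerL package; no docstring in the source.) -/
@[simp] theorem I.mk_fst (μ : GramClass L → InfinitePlace (L : Type) → ℤ) (q : GramClass L) (s : PairSplittingAt V ρ q)
    (hs : IsCompatAt V ρ q s) (hm : HasCentralTypeAt V (ρ q) s (μ (GramClass.mk (ρ q)))) : (I.mk V ρ μ q s hs hm).1 = q := rfl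


-- port_pkg: scope closed for this part
end LiuIndex
end HodgeCM.Model
end
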